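import Literature.Probability.RandomPlanarGeometry.RestrictionMeasuresFiveEighthsInteriorHolds
import HarnessLib

/-!
# `Ξ(κ)` has interior points, from Theorem 7.3 alone: `SLEBubbles.ae_interior_nonempty` without the interior property of the bubbles

Proof-only companion (no definition, no named fact) of
`Literature.Probability.RandomPlanarGeometry.SLEBubbles` ([LSW] §7.2), after

* G. F. Lawler, O. Schramm, W. Werner, *Conformal restriction: the chordal case*, J. Amer. Math.
  Soc. **16** (2003) 917–955, arXiv:math/0209343 (**[LSW]**), Thm. 7.3 (p. 29: "For any
  `κ ∈ [0, 8/3]`, the law of `Ξ(κ)` is `P_{α_κ}`") and the sentence following its proof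
  (p. 29: "The theorem shows that for all `α > 5/8`, the measure `P_α` exists … The frontier
  of the set defined under `P_α` has Hausdorff dimension `4/3` (because of the Brownian
  bubbles)"), p. 5 result 2 ("The only measure `P_α` that is supported on simple curves is
  `P_{5/8}`").

The named fact `SLEBubbles.ae_interior_nonempty` ("for `0 < κ < 8/3`, a Brownian bubble measure
`μ` and an independent Poisson cloud of bubbles with mean `λ_κ μ ⊗ dt`, almost surely `Ξ(κ)` has
an interior point") was so far reduced to the interior property of the BUBBLES
(`IsBrownianBubbleMeasure.ae_interior_nonempty`, `SLEBubbles.ae_interior_nonempty_of_ae_interior_nonempty`;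
or its existential form, `SLEBubbles.ae_interior_nonempty_of_exists`), whose proof needs the
construction of [LSW]'s measure of filled Brownian loops (§7.1), absent from the tree (review of
the D-0026 decomposition, 2026-08-15: the prove-seat of the fact triaged this as a whole theory).

Here the fact is derived WITHOUT any statement about the interior of the bubbles, from the two
remaining leaves of Theorem 7.3 alone:

* `hcfg : SLEBubbles.ae_mem_restrictionConfigs` — `Ξ(κ) ∈ Ω` almost surely (the closedness
  statement `cl Ξ = Ξ ∪ {0}` ending the proof of Thm. 7.3, p. 29);
* `h65 : SLEBubbles.lintegral_poissonAvoidance_eq_rpow` — Theorem 6.5 read through (7.2), the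
  analytic input of the avoidance formula (7.3).

The argument (`SLEBubbles.ae_interior_nonempty_of_thm73`): the hypotheses of the fact CONTAIN a
Brownian bubble measure `μ`, so `exists_isBrownianBubbleMeasure` holds in context; by Thm. 7.3
(version `h₁` + avoidance formula `h₂`, `SLEBubbles.isRestrictionMeasure_map`) the law of a
measurable version `Kc` of `Ξ(κ)` is `P_{α_κ}` with `α_κ = (6 − κ)/(2κ) > 5/8` for `κ < 8/3`
(`five_eighths_lt_sleBubbleExponent`); Thm. 7.3 at `κ = 2` (`α₂ = 1`, the cloud supplied by
Kingman's theorem, `exists_isRestrictionMeasure_of_five_eighths_le_of_thm73`) gives a two-sided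
restriction measure of exponent `1`; hence, by the tree's bubble-free proof of the `α > 5/8`
leaf (`IsRestrictionMeasure.ae_interior_nonempty_of_gt_five_eighths_of_exists_one`,
`RestrictionMeasuresFiveEighthsInteriorHolds`: one-sided squeeze against the hung excursion
cloud for positivity, the zero–one law of `RestrictionZeroOne` for almost sureness),
`P_{α_κ}`-almost every configuration has an interior point, and this pulls back along `Kc = Ξ(κ)`
a.e. (`MeasureTheory.ae_of_ae_map`).

Contents (all PROVED):

* `five_eighths_lt_sleBubbleExponent` — `α_κ > 5/8` for `0 < κ < 8/3`;
* `SLEBubbles.ae_interior_nonempty_of_thm73` — the fact from the two halves of Thm. 7.3 as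
  stated in `SLEBubbles` (`SLEBubbles.exists_measurable_version`, `SLEBubbles.measure_disjoint`);
* `SLEBubbles.ae_interior_nonempty_of_two_leaves` — the fact from `hcfg` and `h65`; its
  discharge `SLEBubbles.ae_interior_nonempty_holds` is this theorem applied to
  `SLEBubbles.ae_mem_restrictionConfigs_holds` and
  `SLEBubbles.lintegral_poissonAvoidance_eq_rpow_holds`, once they exist — the SAME two leaves
  every other §7 consequence of the tree waits on (`…_of_three_leaves'` theorems of
  `OneSidedExcursionCloudInterior`, the third leaf `exists_isBrownianBubbleMeasure` being in
  context here);
* `SLEBubbles.ae_interior_nonempty_of_closedness` — the same with `hcfg` in its printed form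
  (`cl Ξ = Ξ ∪ {0}` a.s. and Def. 3.1 (2) for `Ξ`, `SLEBubbles.ae_mem_restrictionConfigs_of_closedness`).

So the named fact carries no proof obligation of its own beyond Thm. 7.3: neither the
construction of the Brownian bubble measure nor the interior of filled Brownian loops is needed.

## References

* [LSW] Thm. 7.3 and p. 29; p. 5 result 2; Thm. 6.5; §3 p. 10; §8.1–8.2. [LawlerSchrammWerner2003Restriction]
-/

noncomputable section

open Set Filter Topology MeasureTheory
open scoped NNReal ENNReal
open Literature.Probability.Process (preWienerMeasure IsPoissonCloud)

namespace Literature.Probability.RandomPlanarGeometry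

/-- **`α_κ > 5/8` for `0 < κ < 8/3`** (`α_κ = (6 − κ)/(2κ)`; [LSW] p. 29: `α_{8/3} = 5/8`, and
`α_κ` decreases in `κ`). [cite: LawlerSchrammWerner2003Restriction, §7.2 (p. 29)] -/
theorem five_eighths_lt_sleBubbleExponent {κ : ℝ≥0} (h0 : 0 < κ) (h : κ < 8 / 3) :
    5 / 8 < sleBubbleExponent κ := by
  have h0' : (0 : ℝ) < κ := by exact_mod_cast h0
  have h' : (κ : ℝ) < 8 / 3 := by exact_mod_cast h
  unfold sleBubbleExponent
  rw [lt_div_iff₀ (by positivity)]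
  linarith

/-- **`Ξ(κ)` has interior points, from the two halves of Theorem 7.3** (as stated in
`SLEBubbles`: `h₁`, a measurable `Ω`-valued version of `Ξ(κ)`; `h₂`, the avoidance formula
(7.3)): for `0 < κ < 8/3`, a Brownian bubble measure `μ` and an independent Poisson cloud with
mean `λ_κ μ ⊗ dt`, almost surely `Ξ(κ)` has an interior point — the law of the version is
`P_{α_κ}`, `α_κ > 5/8`, Thm. 7.3 at `κ = 2` with the same `μ` gives `P_1`, and every `P_α`,
`α > 5/8`, is carried by configurations with interior points as soon as `P_1` exists
(`IsRestrictionMeasure.ae_interior_nonempty_of_gt_five_eighths_of_exists_one`). No property of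
the bubbles beyond (7.2) is used. [cite: LawlerSchrammWerner2003Restriction, Thm. 7.3 (p. 29) and p. 5 result 2] -/
theorem SLEBubbles.ae_interior_nonempty_of_thm73
    (h₁ : SLEBubbles.exists_measurable_version) (h₂ : SLEBubbles.measure_disjoint) :
    SLEBubbles.ae_interior_nonempty := by
  intro κ hκ0 hκ μ hμ Ω' _ P' X hX
  -- Thm. 7.3: a measurable version `Kc` of `Ξ(κ)` with law `P_{α_κ}`
  obtain ⟨Kc, hKc, hae, hP⟩ := SLEBubbles.isRestrictionMeasure_map h₁ h₂ hκ0 hκ.le hμ hX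
  -- Thm. 7.3 at `κ = 2` with the bubble measure `μ` in context: `P_1` exists
  have h1 : ∃ P₁ : Measure RestrictionConfig, IsRestrictionMeasure 1 P₁ :=
    exists_isRestrictionMeasure_of_five_eighths_le_of_thm73 ⟨μ, hμ⟩ h₁ h₂ (by norm_num)
  -- the bubble-free `α > 5/8` leaf, for the law of `Kc`
  have hint : ∀ᵐ K : RestrictionConfig ∂(preWienerMeasure.prod P').map Kc,
      (interior (K : Set ℂ)).Nonempty :=
    IsRestrictionMeasure.ae_interior_nonempty_of_gt_five_eighths_of_exists_one h1 hP
      (five_eighths_lt_sleBubbleExponent hκ0 hκ)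
  -- pull back along the version
  filter_upwards [ae_of_ae_map hKc.aemeasurable hint, hae] with p hp hpeq
  rwa [hpeq] at hp

/-- **`Ξ(κ)` has interior points, from the two remaining leaves of Theorem 7.3**: `Ξ(κ) ∈ Ω`
almost surely (`hcfg`, the closedness statement of p. 29) and Theorem 6.5 read through (7.2)
(`h65`), the measurability halves of Thm. 7.3 and Kingman's theorem being theorems of the tree
(`SLEBubbles.exists_measurable_version_of_ae_mem`, `SLEBubbles.measure_disjoint_of_thm65`). The
discharge `SLEBubbles.ae_interior_nonempty_holds` is this theorem applied to
`SLEBubbles.ae_mem_restrictionConfigs_holds` and `SLEBubbles.lintegral_poissonAvoidance_eq_rpow_holds`,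
once they exist. [cite: LawlerSchrammWerner2003Restriction, Thm. 7.3 (p. 29) with Thm. 6.5, and p. 5 result 2] -/
theorem SLEBubbles.ae_interior_nonempty_of_two_leaves
    (hcfg : SLEBubbles.ae_mem_restrictionConfigs) (h65 : SLEBubbles.lintegral_poissonAvoidance_eq_rpow) :
    SLEBubbles.ae_interior_nonempty :=
  SLEBubbles.ae_interior_nonempty_of_thm73 (SLEBubbles.exists_measurable_version_of_ae_mem hcfg)
    (SLEBubbles.measure_disjoint_of_thm65 h65)

/-- **The same with the sample-path leaf in its printed form**: `cl Ξ = Ξ ∪ {0}` almost surely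
(`hcl`, [LSW] p. 29: "all that remains is to show that `cl Ξ = Ξ ∪ {0}`"), the a.s.
connectedness of `ℂ ∖ cl Ξ` (`hcc`, Def. 3.1 (2), implicit in the statement of Thm. 7.3) and
Theorem 6.5 (`h65`). [cite: LawlerSchrammWerner2003Restriction, Thm. 7.3 and end of its proof (p. 29), with Def. 3.1 (p. 10)] -/
theorem SLEBubbles.ae_interior_nonempty_of_closedness
    (hcl : ∀ {κ : ℝ≥0}, 0 < κ → κ ≤ 8 / 3 → ∀ {μ : Measure BubbleConfig}, IsBrownianBubbleMeasure μ →
      ∀ {Ω' : Type} [MeasurableSpace Ω'] {P' : Measure Ω'} {X : Ω' → Set (BubbleConfig × ℝ≥0)},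
        IsPoissonCloud (bubbleCloudIntensity κ μ) X P' →
          ∀ᵐ p ∂(preWienerMeasure.prod P'),
            closure (sleBubbleSet κ p.1 (X p.2)) = sleBubbleSet κ p.1 (X p.2) ∪ {0})
    (hcc : ∀ {κ : ℝ≥0}, 0 < κ → κ ≤ 8 / 3 → ∀ {μ : Measure BubbleConfig}, IsBrownianBubbleMeasure μ →
      ∀ {Ω' : Type} [MeasurableSpace Ω'] {P' : Measure Ω'} {X : Ω' → Set (BubbleConfig × ℝ≥0)},
        IsPoissonCloud (bubbleCloudIntensity κ μ) X P' →
          ∀ᵐ p ∂(preWienerMeasure.prod P'), IsConnected (closure (sleBubbleSet κ p.1 (X p.2)))ᶜ)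
    (h65 : SLEBubbles.lintegral_poissonAvoidance_eq_rpow) :
    SLEBubbles.ae_interior_nonempty :=
  SLEBubbles.ae_interior_nonempty_of_two_leaves (SLEBubbles.ae_mem_restrictionConfigs_of_closedness hcl hcc) h65

end Literature.Probability.RandomPlanarGeometry

end
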